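import Summits.ABC.ABC.Theorems.IsogenyGlueCongruenceEllipticGluingPrimeBoundStubBigImageTorsionCoreAux1
import Literature.NumberTheory.EllipticCurves.GaloisAction
import HarnessLib

/-!
# Big-image torsion core, helpers 2/5: big image spans `End(V)`; the core, step 0

Helper file (2/5) for stub `stub_bigImageTorsionCore` ((N†), the big-image torsion core) of
line `Sketch` (isotypic–Minkowski reduction) of crux U
`Summit.ABC.ABC.Theses.IsogenyGlueCongruence.EllipticGluingPrimeBound` (stmt-ABC-13919); the stub
itself is proved in `…EllipticGluingPrimeBoundStubBigImageTorsionCore`.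

* `span_smul_eq_top` — if a group `Γ` acts on a plane `V/𝔽_ℓ` (`ℓ` odd) so that every additive
  automorphism of `V` is some `σ ∈ Γ` (surjectivity of `ρ̄`), and `Γ' ◁ Γ` contains a power of
  exponent prime to `ℓ` of every element, then the operators of `Γ'` span `End(V)` (classically
  `ρ̄(Γ') ⊇ SL₂(𝔽_ℓ)`): in a basis the span is conjugation-stable and contains the non-scalar
  power `!![1, n; 0, 1]` of a transvection (`submodule_matrix_eq_top`, helpers 1/5);
* `exists_stable_onto_torsion` (registered sub-goal) — step 0 of the core: from the evaluation `ev
    : H → Hom(P, A)`,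
  an equivariant `ι : P[ℓ] ↪ A` and "every `ℓ`-torsion element of `A` is a sum of values
  `ev f y`, `ℓᵏ y = 0`", an `ℓ`-torsion subgroup of `P^r` stable under the twisted operators
  surjecting equivariantly onto `P[ℓ]` (`exists_stable_torsion_onto`, helpers 1/5).

Everything is proved; no `def`, no named fact. Deliberately NOT here: steps 1–2 of the core
(helpers 3/5), the geometry (helpers 4–5/5).
-/

noncomputable section

-- `Summit.<Summit>.<Problem>` is the mandated summit-side namespace (CONVENTIONS §2); for the
-- single-conjunct summit `ABC` the two coincide, so the duplicate `ABC.ABC` is deliberate.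
set_option linter.dupNamespace false

namespace Summit.ABC.ABC.Theorems.IsotypicMinkowski

open scoped AddSubgroup

namespace BigImage

/-! ## Big image: the operators of `Γ'` span `End(V)` -/

/-- **Big image ⟹ the operators of `Γ'` span `End(V)`.** Let a group `Γ` act additively on a
plane `V` over `𝔽_ℓ` (`ℓ` odd) so that EVERY additive automorphism of `V` is the action of some
element of `Γ` (surjectivity of `Γ → Aut(V) ≅ GL₂(𝔽_ℓ)`), and let `Γ' ◁ Γ` be a normal subgroup
such that every element of `Γ` has a power of exponent prime to `ℓ` in `Γ'` (e.g. `Γ/Γ'` finite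
of order prime to `ℓ`). Then the `𝔽_ℓ`-span of the operators `v ↦ σ • v`, `σ ∈ Γ'`, is all of
`End(V)`: in a basis it is a conjugation-stable subspace of `M₂(𝔽_ℓ)` containing `1` and the
non-scalar power `!![1, n; 0, 1]` of a transvection (`submodule_matrix_eq_top`). In particular
`Γ'` acts absolutely irreducibly (classically: `ρ̄(Γ') ⊇ SL₂(𝔽_ℓ)`). [folklore] -/
theorem span_smul_eq_top {Γ V : Type} [Group Γ] [AddCommGroup V] {ℓ : ℕ} [Fact ℓ.Prime]
    [Module (ZMod ℓ) V] (hℓ : ℓ ≠ 2) [DistribMulAction Γ V]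
    (b : Module.Basis (Fin 2) (ZMod ℓ) V) (hs : ∀ φ : V ≃+ V, ∃ σ : Γ, ∀ v, σ • v = φ v)
    (Γ' : Subgroup Γ) [Γ'.Normal] (hpow : ∀ σ : Γ, ∃ n : ℕ, ¬ ℓ ∣ n ∧ σ ^ n ∈ Γ') :
    Submodule.span (ZMod ℓ)
      (Set.range fun σ : Γ' ↦ (DistribSMul.toAddMonoidHom V (σ : Γ)).toZModLinearMap ℓ) = ⊤ := by
  classical
  -- the action as a monoid homomorphism `T : Γ → End(V)`
  let T : Γ →* (V →ₗ[ZMod ℓ] V) :=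
    { toFun := fun σ ↦ (DistribSMul.toAddMonoidHom V σ).toZModLinearMap ℓ
      map_one' := by ext v; exact one_smul Γ v
      map_mul' := fun σ τ ↦ by ext v; exact mul_smul σ τ v }
  have hT : ∀ σ v, T σ v = σ • v := fun σ v ↦ rfl
  change Submodule.span (ZMod ℓ) (Set.range fun σ : Γ' ↦ T σ) = ⊤
  -- every linear automorphism is some `T σ`
  have hsT : ∀ φ φ' : V →ₗ[ZMod ℓ] V, φ * φ' = 1 → φ' * φ = 1 →
      ∃ σ : Γ, T σ = φ ∧ T σ⁻¹ = φ' := by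
    intro φ φ' h h'
    let eφ : V ≃ₗ[ZMod ℓ] V := LinearEquiv.ofLinear φ φ' h h'
    obtain ⟨σ, hσ⟩ := hs eφ.toAddEquiv
    have hσ' : T σ = φ := by ext v; exact hσ v
    refine ⟨σ, hσ', ?_⟩
    have hinv : T σ⁻¹ * T σ = 1 := by rw [← map_mul, inv_mul_cancel, map_one]
    calc T σ⁻¹ = T σ⁻¹ * (φ * φ') := by rw [h, mul_one]
      _ = φ' := by rw [← hσ', ← mul_assoc, hinv, one_mul]
  -- pass to matrices
  let e := LinearMap.toMatrixAlgEquiv b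
  set 𝒜 : Submodule (ZMod ℓ) (Matrix (Fin 2) (Fin 2) (ZMod ℓ)) :=
    (Submodule.span (ZMod ℓ) (Set.range fun σ : Γ' ↦ T σ)).map e.toLinearEquiv.toLinearMap
    with h𝒜def
  have hmem𝒜 : ∀ σ : Γ, σ ∈ Γ' → e (T σ) ∈ 𝒜 := fun σ hσ ↦
    Submodule.mem_map_of_mem (Submodule.subset_span ⟨⟨σ, hσ⟩, rfl⟩)
  suffices h𝒜 : 𝒜 = ⊤ by
    apply Submodule.map_injective_of_injective e.toLinearEquiv.injective
    rw [← h𝒜def, h𝒜, Submodule.map_top, LinearEquiv.range]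
  -- a transvection and its non-scalar power in `𝒜`
  have hmat : (!![1, 1; 0, 1] : Matrix (Fin 2) (Fin 2) (ZMod ℓ)) * !![1, -1; 0, 1] = 1 := by
    ext i j; fin_cases i <;> fin_cases j <;> simp
  have hmat' : (!![1, -1; 0, 1] : Matrix (Fin 2) (Fin 2) (ZMod ℓ)) * !![1, 1; 0, 1] = 1 := by
    ext i j; fin_cases i <;> fin_cases j <;> simp
  obtain ⟨σ₀, hσ₀, -⟩ := hsT (e.symm !![1, 1; 0, 1]) (e.symm !![1, -1; 0, 1])
    (by rw [← map_mul e.symm, hmat, map_one]) (by rw [← map_mul e.symm, hmat', map_one])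
  obtain ⟨n, hn, hσ₀n⟩ := hpow σ₀
  have hpow' : ∀ m : ℕ, (!![1, 1; 0, 1] : Matrix (Fin 2) (Fin 2) (ZMod ℓ)) ^ m = !![1, (m : ZMod
      ℓ); 0, 1] := by
    intro m
    induction m with
    | zero => rw [pow_zero]; ext i j; fin_cases i <;> fin_cases j <;> simp
    | succ m ih =>
      rw [pow_succ, ih]
      ext i j; fin_cases i <;> fin_cases j <;> simp [add_comm]
  have ha : (!![1, (n : ZMod ℓ); 0, 1] : Matrix (Fin 2) (Fin 2) (ZMod ℓ)) ∈ 𝒜 := by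
    have h := hmem𝒜 _ hσ₀n
    rwa [map_pow, hσ₀, map_pow, AlgEquiv.apply_symm_apply, hpow'] at h
  refine submodule_matrix_eq_top hℓ 𝒜 ?_ ?_ ha (Or.inr (Or.inl ?_))
  · -- `1 ∈ 𝒜`
    have h := hmem𝒜 1 Γ'.one_mem
    rwa [map_one, map_one] at h
  · -- conjugation stability
    intro g g' hgg' a ha'
    have hg'g : g' * g = 1 := mul_eq_one_comm.1 hgg'
    obtain ⟨σ, hσ, hσ'⟩ := hsT (e.symm g) (e.symm g')
      (by rw [← map_mul, hgg', map_one]) (by rw [← map_mul, hg'g, map_one])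
    rw [h𝒜def, Submodule.mem_map] at ha'
    obtain ⟨ψ, hψ, rfl⟩ := ha'
    have hconj : T σ * ψ * T σ⁻¹ ∈ Submodule.span (ZMod ℓ) (Set.range fun σ : Γ' ↦ T σ) := by
      refine Submodule.span_induction ?_ ?_ ?_ ?_ hψ
      · rintro _ ⟨τ, rfl⟩
        refine Submodule.subset_span
          ⟨⟨σ * τ * σ⁻¹, (inferInstance : Γ'.Normal).conj_mem _ τ.2 σ⟩, ?_⟩
        change T (σ * τ * σ⁻¹) = _
        rw [map_mul, map_mul]
      · rw [mul_zero, zero_mul]; exact Submodule.zero_mem _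
      · intro x y _ _ hx hy
        rw [mul_add, add_mul]; exact Submodule.add_mem _ hx hy
      · intro c x _ hx
        rw [mul_smul_comm, smul_mul_assoc]; exact Submodule.smul_mem _ c hx
    have h := Submodule.mem_map_of_mem (f := e.toLinearEquiv.toLinearMap) hconj
    rw [← h𝒜def] at h
    convert h using 1
    change g * e ψ * g' = e (T σ * ψ * T σ⁻¹)
    rw [map_mul, map_mul, hσ, hσ', AlgEquiv.apply_symm_apply, AlgEquiv.apply_symm_apply]
  · -- non-scalar
    intro h
    apply hn
    rw [← ZMod.natCast_eq_zero_iff]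
    simpa using h

end BigImage

/-! ## The core, step 0 (registered sub-goal of the stub) -/

/-- **Core, step 0: an `ℓ`-torsion stable subgroup of `H ⊗ P` surjecting onto `V = P[ℓ]`.**
Data: a group `Γ` acting additively on `P` and `A`; a free `ℤ`-lattice `H` of finite rank with a
`ℤ`-linear `Γ`-action `ρ`; an evaluation `ev : H → Hom(P, A)` with `ev(σf)(σy) = σ(ev f y)`;
an equivariant embedding `ι : P[ℓ] ↪ A`; every `ℓ`-torsion element of `A` a sum of values
`ev f y` with `ℓᵏ y = 0`; `P[ℓ]` irreducible. In the basis `b` of `H`, `Φ(R) = Σ ev(bᵢ)(Rᵢ)` on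
`M = P^r` is equivariant for the twisted operators `s_σ(R)_k = Σᵢ c(σ)_{ki} σRᵢ`
(`c(σ)` the matrix of `ρ(σ)`), and maps the `ℓᵏ`-torsion onto `ι(P[ℓ])`; the torsion filtration
(`exists_stable_torsion_onto`) cuts this down to the `ℓ`-torsion. [folklore] -/
theorem exists_stable_onto_torsion {Γ P A H : Type} [Group Γ] [AddCommGroup P] [AddCommGroup A]
    [AddCommGroup H] [DistribMulAction Γ P] [DistribMulAction Γ A] {ℓ : ℕ}
    (hV : ∀ S : AddSubgroup (AddSubgroup.torsionBy P ℓ), (∀ σ : Γ, ∀ v ∈ S, σ • v ∈ S) → S = ⊥ ∨ S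
        = ⊤)
    (ρ : Representation ℤ Γ H) {r : ℕ} (b : Module.Basis (Fin r) ℤ H) (ev : H →+ P →+ A)
    (hev : ∀ (σ : Γ) (f : H) (y : P), ev (ρ σ f) (σ • y) = σ • ev f y)
    (ι : AddSubgroup.torsionBy P ℓ →+ A) (hι : Function.Injective ι)
    (hισ : ∀ (σ : Γ) (v : AddSubgroup.torsionBy P ℓ), ι (σ • v) = σ • ι v)
    (hsurj : ∃ k : ℕ, ∀ Q : A, ℓ • Q = 0 →
      Q ∈ AddSubgroup.closure {Q' | ∃ (f : H) (y : P), (ℓ ^ k) • y = 0 ∧ Q' = ev f y}) :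
    ∃ (S : AddSubgroup (Fin r → P))
      (hS : ∀ σ : Γ, ∀ R ∈ S, (fun k ↦ ∑ i, LinearMap.toMatrix b b (ρ σ) k i • σ • R i) ∈ S)
      (π' : S →+ AddSubgroup.torsionBy P ℓ),
      (∀ R ∈ S, ℓ • R = 0) ∧ Function.Surjective π' ∧
      ∀ (σ : Γ) (R : S), π' ⟨_, hS σ R R.2⟩ = σ • π' R := by
  classical
  -- `Φ` and the twisted operators
  let Φ : (Fin r → P) →+ A := ∑ i, (ev (b i)).comp (Pi.evalAddMonoidHom (fun _ ↦ P) i)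
  have hΦ : ∀ R, Φ R = ∑ i, ev (b i) (R i) := fun R ↦ by
    simp only [Φ, AddMonoidHom.finsetSum_apply, AddMonoidHom.coe_comp, Function.comp_apply,
      Pi.evalAddMonoidHom_apply]
  let s : Γ → (Fin r → P) →+ (Fin r → P) := fun σ ↦ AddMonoidHom.pi fun k ↦
    ∑ i, LinearMap.toMatrix b b (ρ σ) k i • ((DistribSMul.toAddMonoidHom P σ).comp
        (Pi.evalAddMonoidHom (fun _ ↦ P) i))
  have hs : ∀ σ R, s σ R = fun k ↦ ∑ i, LinearMap.toMatrix b b (ρ σ) k i • σ • R i := fun σ R ↦ by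
    ext k
    simp only [s, AddMonoidHom.pi_apply, AddMonoidHom.finsetSum_apply, AddMonoidHom.smul_apply,
      AddMonoidHom.coe_comp, Function.comp_apply, Pi.evalAddMonoidHom_apply,
      DistribSMul.toAddMonoidHom_apply]
  -- equivariance of `Φ`
  have hρb : ∀ σ i, ρ σ (b i) = ∑ k, LinearMap.toMatrix b b (ρ σ) k i • b k := fun σ i ↦ by
    simp only [LinearMap.toMatrix_apply, Module.Basis.sum_repr]
  have hΦs : ∀ σ R, Φ (s σ R) = σ • Φ R := fun σ R ↦ by
    rw [hs, hΦ, hΦ, Finset.smul_sum]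
    simp_rw [map_sum, map_zsmul]
    rw [Finset.sum_comm]
    refine Finset.sum_congr rfl fun i _ ↦ ?_
    rw [← hev σ (b i) (R i), hρb, map_sum, AddMonoidHom.finsetSum_apply]
    simp only [map_zsmul, AddMonoidHom.smul_apply]
  -- values of `ev` lie in the image of the torsion under `Φ`
  have hevΦ : ∀ (f : H) (y : P), ev f y = Φ (fun i ↦ b.repr f i • y) := fun f y ↦ by
    conv_lhs => rw [← b.sum_repr f]
    rw [map_sum, AddMonoidHom.finsetSum_apply, hΦ]
    simp only [map_zsmul, AddMonoidHom.smul_apply]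
  obtain ⟨k, hk⟩ := hsurj
  -- the initial stable subgroup and its surjection onto `P[ℓ]`
  let M₀ : AddSubgroup (Fin r → P) :=
    AddSubgroup.torsionBy (Fin r → P) (ℓ ^ k : ℕ) ⊓ ι.range.comap Φ
  have hmemM₀ : ∀ R, R ∈ M₀ ↔ (ℓ ^ k) • R = 0 ∧ Φ R ∈ ι.range := fun R ↦ by
    rw [AddSubgroup.mem_inf, AddSubgroup.torsionBy.nsmul_iff, AddSubgroup.mem_comap]
  have hM₀k : ∀ R ∈ M₀, (ℓ ^ k) • R = 0 := fun R hR ↦ ((hmemM₀ R).1 hR).1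
  have hιtors : ∀ v : AddSubgroup.torsionBy P ℓ, ℓ • ι v = 0 := fun v ↦ by
    rw [← map_nsmul, AddSubgroup.torsionBy.nsmul, map_zero]
  have hrange_stable : ∀ (σ : Γ), ∀ Q ∈ ι.range, σ • Q ∈ ι.range := by
    rintro σ _ ⟨v, rfl⟩
    exact ⟨σ • v, hισ σ v⟩
  have hM₀st : ∀ σ, ∀ R ∈ M₀, s σ R ∈ M₀ := fun σ R hR ↦ by
    rw [hmemM₀] at hR ⊢
    refine ⟨by rw [← map_nsmul, hR.1, map_zero], ?_⟩
    rw [hΦs]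
    exact hrange_stable σ _ hR.2
  let Φ₀ : M₀ →+ ι.range := (Φ.comp M₀.subtype).codRestrict ι.range fun R ↦ ((hmemM₀ R).1 R.2).2
  let π₀ : M₀ →+ AddSubgroup.torsionBy P ℓ := (AddMonoidHom.ofInjective
      hι).symm.toAddMonoidHom.comp Φ₀
  have hπ₀ : ∀ R : M₀, ι (π₀ R) = Φ R := fun R ↦ by
    change ι ((AddMonoidHom.ofInjective hι).symm (Φ₀ R)) = _
    rw [AddMonoidHom.apply_ofInjective_symm]
    rfl
  have hπ₀surj : Function.Surjective π₀ := by
    intro v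
    have hQ := hk (ι v) (hιtors v)
    -- the closure lies in `Φ` of the `ℓᵏ`-torsion
    have hsub : AddSubgroup.closure {Q' | ∃ (f : H) (y : P), (ℓ ^ k) • y = 0 ∧ Q' = ev f y} ≤
        (AddSubgroup.torsionBy (Fin r → P) (ℓ ^ k : ℕ)).map Φ := by
      rw [AddSubgroup.closure_le]
      rintro _ ⟨f, y, hy, rfl⟩
      refine ⟨fun i ↦ b.repr f i • y, ?_, (hevΦ f y).symm⟩
      rw [SetLike.mem_coe, AddSubgroup.torsionBy.nsmul_iff]
      ext i
      simp only [Pi.smul_apply, Pi.zero_apply, smul_comm _ (b.repr f i), hy, smul_zero]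
    obtain ⟨R, hR, hRv⟩ := hsub hQ
    have hRM₀ : R ∈ M₀ := (hmemM₀ R).2 ⟨AddSubgroup.torsionBy.nsmul_iff.1 hR, hRv ▸ ⟨v, rfl⟩⟩
    exact ⟨⟨R, hRM₀⟩, hι (by rw [hπ₀]; exact hRv)⟩
  have hπ₀t : ∀ σ (R : M₀), π₀ ⟨s σ R, hM₀st σ R R.2⟩ =
      DistribSMul.toAddMonoidHom _ σ (π₀ R) := fun σ R ↦ by
    apply hι
    rw [hπ₀, DistribSMul.toAddMonoidHom_apply, hισ, hπ₀]
    exact hΦs σ R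
  -- the torsion filtration
  have hV' : ∀ S : AddSubgroup (AddSubgroup.torsionBy P ℓ),
      (∀ σ : Γ, ∀ v ∈ S, DistribSMul.toAddMonoidHom _ σ v ∈ S) → S = ⊥ ∨ S = ⊤ :=
    fun S hS ↦ hV S fun σ v hv ↦ hS σ v hv
  obtain ⟨S, hS, π', -, hSℓ, hπ's, hπ't⟩ := exists_stable_torsion_onto s
    (fun σ : Γ ↦ DistribSMul.toAddMonoidHom (AddSubgroup.torsionBy P ℓ) σ) hV' ℓ k M₀ hM₀k hM₀st π₀
        hπ₀surj hπ₀t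
  have hS' : ∀ σ : Γ, ∀ R ∈ S, (fun k ↦ ∑ i, LinearMap.toMatrix b b (ρ σ) k i • σ • R i) ∈ S := fun
      σ R hR ↦ by
    rw [← hs]; exact hS σ R hR
  refine ⟨S, hS', π', hSℓ, hπ's, fun σ R ↦ ?_⟩
  have h := hπ't σ R
  rw [DistribSMul.toAddMonoidHom_apply] at h
  rw [← h]
  congr 1
  exact Subtype.ext (hs σ R).symm


end Summit.ABC.ABC.Theorems.IsotypicMinkowski

end
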